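import Summits.ABC.ABC.Theses.DefiniteXi
import Literature.NumberTheory.EllipticCurves.TakahashiDegreeFormulaCoprimeProofs
import Literature.NumberTheory.EllipticCurves.SzpiroFreyConductorProofs
import HarnessLib

/-!
# STUB-IDEAS companion — `stub_takahashi` · ideator k3 · generation 16 (FAMILY 3: probe the extremes)

Crux `stmt-ABC-11338` (`DefiniteXi.DefiniteRTControlPrime`), stub
`theorem stub_takahashi : takahashi2001_thm_2_3_of_coprime` (cite-tagged named fact, Takahashi 2001 Thm 2.3 at `r ∥ N`).

Gen 16 adds ONE typed object to the k3 record (g15 companion `StubIdeas3g15Sketch.lean` — N1/E1/E2/G —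
re-checked today, rc 0, 0 sorries, and standing by reference):

* `TwoPartOfDegreeSubpoly` — the QUARANTINE HYPOTHESIS every prime-by-prime detour around the stub needs
  ("the 2-part of the optimal modular degree is sub-polynomial in `N` on Frey pivots"), typed on the
  Legendre–Proth Frey family `E_(−p, p−1)`, `32 ∣ p − 1`, with exactly the binders of the landed
  `Summit.ABC.ABC.Theorems.EisensteinQuarantine.Negative.EtaTwoDegreeDepthLaw`;
* `NoTwoAdicQuarantine` — the target (statement only; one S/M prover cycle of real-analysis bookkeeping):
  the census-backed degree depth law + the deep-2 Proth supply (ERH-true) + Frey modularity REFUTE the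
  quarantine hypothesis.  Reading: on this extremal family `ord₂ δ_opt ≥ m₂(p) − c` with `2^{m₂(p)} ≥ N^{1/(2A) − o(1)}`,
  so a proof of `δ ≤ C N^ε · ξ · c_q` must move the 2-part of `δ` INTO `ξ` — which the all-primes identity
  `δ i_q² = ξ c_q` (the stub) does and no `p`-by-`p` comparison theorem in print (Pollack–Weston 2011 Thm 6.8:
  `p ≥ 5`, `p ∤ N`, CR; Böckle–Khare–Manning 2021 / Iyengar–Khare–Manning 2025: non-Eisenstein maximal ideals) can.

IMPORT NOTE. The tree module defining `twoDepth` / `EtaTwoDegreeDepthLaw` / `DeepTwoProthSupply`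
(`Summits.ABC.ABC.Theorems.EisensteinQuarantine.Negative.EisensteinQuarantineFalseOfEtaTwoDepthLaw`) sits behind
`…Negative.EisensteinQuarantineFalseOfForcedPairOccurrence`, which the farm snapshot reports UNBUILT today
(`remote:stale:1425:unbuilt`, rc 75 twice, 00:46Z / 00:51Z).  So this companion carries VERBATIM LOCAL COPIES of those
three definitions (suffix-free names inside this file's own namespace; text identical to the tree's, lines 53 / 108 / 140
of that module) and cites the landed transfer theorems `ordProj_modularDegree_le_of_takahashi`,
`pow_le_ordProj_brandtXi_of_degreeBound` (p135429) and `etaTwoDepthLaw_of_degreeDepthLaw` BY NAME only.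
-/

set_option linter.dupNamespace false

noncomputable section

namespace Summit.ABC.ABC.Cruxes.DefiniteRTControlPrime.StubIdeas3G16

open Literature.NumberTheory.EllipticCurves
open Literature.NumberTheory.EllipticCurves.ModularForms
open Literature.NumberTheory.Automorphic

/-! ## Verbatim local copies (see IMPORT NOTE) -/

/-- LOCAL COPY (verbatim) of `Summit.ABC.ABC.Theorems.EisensteinQuarantine.Negative.twoDepth`:
`m₂(p) := v₂((p − 1) / ord_p 2)`, the 2-power residuacity depth of `2` modulo `p`. [cite: CalegariEmerton2005, Prop. 3.17(ii)] -/
def twoDepth (p : ℕ) : ℕ := padicValNat 2 ((p - 1) / orderOf (2 : ZMod p))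

/-- LOCAL COPY (verbatim) of `…EisensteinQuarantine.Negative.DeepTwoProthSupply` (TRUE under ERH, open unconditionally):
for some `A`, arbitrarily large `s` and primes `p ≤ 2^{A s}` with `2^s ∣ p − 1` and `s ≤ m₂(p)`. [folklore] -/
def DeepTwoProthSupply : Prop :=
  ∃ A : ℕ, ∀ s₀ : ℕ, ∃ s p : ℕ, s₀ ≤ s ∧ p.Prime ∧ 2 ^ s ∣ p - 1 ∧ p ≤ 2 ^ (A * s) ∧ s ≤ twoDepth p

/-- LOCAL COPY (verbatim) of `…EisensteinQuarantine.Negative.EtaTwoDegreeDepthLaw` (census-backed hypothesis, kit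
j020814/j020843, NOT proved): `2^{m₂(p)} · ordProj[2] c_p(W) ≤ 2^c · ordProj[2] δ(P)` for newform-minimal data `P` of
curves `W` with the `a`-sequence of `E_(−p, p−1)`, `p ≡ 1 (mod 32)`. [folklore] -/
def EtaTwoDegreeDepthLaw : Prop :=
  ∃ c : ℕ, ∀ p : ℕ, p.Prime → 2 ^ 5 ∣ p - 1 →
    ∀ (N : ℕ) [NeZero N], (freyCurve (-(p : ℤ)) ((p - 1 : ℕ) : ℤ)).conductorNorm ℤ = N →
    ∀ (W : WeierstrassCurve ℚ) [W.IsElliptic] (P : ModularParametrizationData W N),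
      (∀ n : ℕ, W.LFunction n = (freyCurve (-(p : ℤ)) ((p - 1 : ℕ) : ℤ)).LFunction n) →
      (∀ (W' : WeierstrassCurve ℚ) [W'.IsElliptic] (P' : ModularParametrizationData W' N),
          P'.f = P.f → P.modularDegree ≤ P'.modularDegree) →
      2 ^ twoDepth p * ordProj[2] ((W.minimalDiscriminantNorm ℤ).factorization p) ≤
        2 ^ c * ordProj[2] P.modularDegree

/-! ## The gen-16 objects -/

/-- **Q — the 2-adic quarantine hypothesis** (what a prime-by-prime replacement of `stub_takahashi` would
have to prove separately at the Eisenstein prime `2`): for every `ε > 0` there is `C` with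
`ordProj[2] δ(P) ≤ C · N^ε` for every newform-minimal datum `P` of every curve `W` with the `a`-sequence of
the Legendre–Proth Frey curve `E_(−p, p−1)` (`p ≡ 1 (mod 32)` prime, `N` its conductor).  Binders verbatim
those of `EtaTwoDegreeDepthLaw`.  Expected FALSE (see `NoTwoAdicQuarantine`). [folklore] -/
def TwoPartOfDegreeSubpoly : Prop :=
  ∀ ε : ℝ, 0 < ε → ∃ C : ℝ, ∀ p : ℕ, p.Prime → 2 ^ 5 ∣ p - 1 →
    ∀ (N : ℕ) [NeZero N], (freyCurve (-(p : ℤ)) ((p - 1 : ℕ) : ℤ)).conductorNorm ℤ = N →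
    ∀ (W : WeierstrassCurve ℚ) [W.IsElliptic] (P : ModularParametrizationData W N),
      (∀ n : ℕ, W.LFunction n = (freyCurve (-(p : ℤ)) ((p - 1 : ℕ) : ℤ)).LFunction n) →
      (∀ (W' : WeierstrassCurve ℚ) [W'.IsElliptic] (P' : ModularParametrizationData W' N),
          P'.f = P.f → P.modularDegree ≤ P'.modularDegree) →
      ((ordProj[2] P.modularDegree : ℕ) : ℝ) ≤ C * (N : ℝ) ^ ε

/-- **Target `NoTwoAdicQuarantine`** (statement only — stub-ideation does not prove): the degree depth law
(`EtaTwoDegreeDepthLaw`), the deep-2 Proth supply (`DeepTwoProthSupply`) and the existence of data for Frey curves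
(`FreyModularity`, route item) refute `TwoPartOfDegreeSubpoly`.
Proof recipe (one cycle): for the supply's `(s, p)` with `s ≥ 5`, `p ≤ 2^{A s}`, `s ≤ m₂(p)`, take `N` = conductor of
`E_(−p,p−1)` (`NeZero` by `conductorNorm_pos_holds`), a datum by `FreyModularity` at `(a, b) = (−p, p−1)`
(coprime, `ab(a+b) = −p(p−1)(−1) ≠ 0`), a newform-minimal one by a well-founded minimum over the newform class
(`W := E` itself is allowed: the law quantifies over all `W` with `a(W) = a(E)`); then
`2^s ≤ 2^{m₂(p)} ≤ 2^{m₂(p)} · ordProj[2] c_p ≤ 2^c · ordProj[2] δ ≤ 2^c · C · N^ε ≤ 2^c C (2^8 p²)^ε ≤ 2^{c+8ε} C · 2^{2Aεs}`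
(`N ∣ 2^8 rad(p(p−1))`, `conductorNorm_freyCurve_dvd_holds`), impossible for `ε < 1/(2A)` and `s → ∞`. [folklore] -/
def NoTwoAdicQuarantine : Prop :=
  EtaTwoDegreeDepthLaw → DeepTwoProthSupply → Summit.ABC.ABC.Theses.DefiniteXi.FreyModularity →
    ¬ TwoPartOfDegreeSubpoly

/-! ## Sanity: the names this memo leans on, by type -/

-- the registered stub's type and the crux decl
#check (takahashi2001_thm_2_3_of_coprime : Prop)
#check (Summit.ABC.ABC.Theses.DefiniteXi.DefiniteRTControlPrime : Prop)
#check (Summit.ABC.ABC.Theses.DefiniteXi.FreyModularity : Prop)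
-- the coprime fact implies the square-free fact used by the landed 2-part transfers (p135429)
example : takahashi2001_thm_2_3_of_coprime → takahashi2001_thm_2_3 :=
  takahashi2001_thm_2_3_of_of_coprime
-- the one-sided consumer inequality of the crux chain (touchpoint of the stub)
#check @takahashi2001_thm_2_3_of_coprime.modularDegree_le_brandtXi_mul
-- the conductor divisibility used in the recipe of `NoTwoAdicQuarantine`
#check @conductorNorm_freyCurve_dvd_holds

end Summit.ABC.ABC.Cruxes.DefiniteRTControlPrime.StubIdeas3G16

end
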